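import Literature.Probability.RandomPlanarGeometry.HexSAWBrickWallStripFugacityWidthOneComplexGap
import Literature.Analysis.Asymptotics.TwoWallCoefficientRecurrences
import HarnessLib

/-!
# The complex Perron data of the width-one two-wall strip: one package for `|t| < t₀`

Topic `Literature/Probability/RandomPlanarGeometry` (assembles `…WidthOneComplexRoot.lean` — `exists_complexPerronRoot` — and
`…WidthOneComplexGap.lean` — `norm_twoWallCubic_real_root_le`, `norm_sub_le_of_newton_location`, `cofactor_roots_le_of_near`,
`rootBound_lt_norm_of_near` — into the hypotheses of `Literature.Analysis.Asymptotics.exists_tendsto_parity_of_rec_six`).  Brick B7 of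
DOOR-ap5-g27 item 1, ASSEMBLED:

* `twoWallCubic_eq_zero_iff` — `F(ω,t) = 0 ⟺ ω(ω − ye^{it})(ω − z) = ye^{it}z` (the `hcubic` shape of the recurrence file).
* ★★ `exists_complexPerronData` — there is `t₀ > 0` such that for every real `|t| < t₀` the two-wall cubic at fugacity `ye^{it}` has a root
  `s(t) ≠ 0` with `|s(t) − s| ≤ C|t|` (`s = μ₁(y,z)²`, `C = 2y(s(s−z)+z)/F_ω(s,0)` EXPLICIT), all roots of the complex cofactor in the closed
  disc of radius `R′ = R₀ + (s − R₀)/2`, and `R′ < ‖s(t)‖`.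
* ★★ `exists_tendsto_parity_complexFugacity` — consequently every complex sequence obeying the order-6 two-wall recurrence at fugacity
  `(ye^{it}, z)` has, along each parity class, the two-term asymptotics `e(2M+c) = L·s(t)^M + O((M+1)R′^M)` with the EXPLICIT constant of
  `exists_tendsto_parity_of_rec_six`.

## Sources
N. R. Beaton et al., CMP 326 (2014), arXiv:1109.0358v5 §3.2 Proposition 6; R. P. Stanley, EC1 §4.1 Theorem 4.1.1 (iii); L. V. Ahlfors (1979) Ch. 4 §3.3.  Lane
statements; nothing is quoted AS PRINTED.
-/

noncomputable section

open Set Metric Filter Complex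
open Literature.Analysis Literature.Analysis.Asymptotics
open scoped Topology

namespace Literature.Probability.RandomPlanarGeometry.SAW.HexBW

namespace WidthOneYZ

variable {y z : ℝ}

/-- `F(ω,t) = 0 ⟺ ω(ω − ye^{it})(ω − z) = ye^{it}·z` — the shape `s(s − w)(s − v) = wv` of
`Literature.Analysis.Asymptotics.exists_tendsto_parity_of_rec_six`. [cite: Stanley2012EC1, §4.1 Theorem 4.1.1 (iii) (lane plumbing)] -/
theorem twoWallCubic_eq_zero_iff (y z : ℝ) (ω : ℂ) (t : ℝ) :
    twoWallCubic y z ω t = 0 ↔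
      ω * (ω - (y : ℂ) * cexp ((t : ℂ) * I)) * (ω - (z : ℂ)) = (y : ℂ) * cexp ((t : ℂ) * I) * (z : ℂ) := by
  unfold twoWallCubic
  constructor
  · intro h; linear_combination h
  · intro h; linear_combination h

/-- ★★ **THE COMPLEX PERRON DATA.**  `s = μ₁(y,z)²`, `D = F_ω(s,0) = (s−y)(s−z) + s(s−z) + s(s−y) > 0`, `R₀ = quadRootBound(s−y−z, yz/s)`,
`R′ = R₀ + (s − R₀)/2`.  There is `t₀ > 0` such that for every real `t` with `|t| < t₀` the cubic `F(·,t)` at fugacity `ye^{it}` has a root `s'`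
with: `s' ≠ 0`; `‖s' − s‖ ≤ (2y(s(s−z)+z)/D)·|t|`; `R′ < ‖s'‖`; and every root `σ` of `σ² + (s' − ye^{it} − z)σ + ye^{it}z/s'` has `‖σ‖ ≤ R′`.
[cite: BeatonBousquetMelouDeGierDuminilCopinGuttmann2014, §3.2 Proposition 6 (lane statement); Ahlfors1979, Ch. 4 §3.3] -/
theorem exists_complexPerronData (hy : 0 < y) (hz : 0 < z) :
    ∃ t₀ > 0, ∀ t : ℝ, |t| < t₀ → ∃ s' : ℂ,
      twoWallCubic y z s' t = 0 ∧ s' ≠ 0 ∧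
      ‖s' - ((stripMuY₂ 1 y z ^ 2 : ℝ) : ℂ)‖
        ≤ 2 * (y * (stripMuY₂ 1 y z ^ 2 * (stripMuY₂ 1 y z ^ 2 - z) + z))
          / ((stripMuY₂ 1 y z ^ 2 - y) * (stripMuY₂ 1 y z ^ 2 - z) + stripMuY₂ 1 y z ^ 2 * (stripMuY₂ 1 y z ^ 2 - z)
              + stripMuY₂ 1 y z ^ 2 * (stripMuY₂ 1 y z ^ 2 - y)) * |t| ∧
      quadRootBound (stripMuY₂ 1 y z ^ 2 - y - z) (y * z / stripMuY₂ 1 y z ^ 2)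
          + (stripMuY₂ 1 y z ^ 2 - quadRootBound (stripMuY₂ 1 y z ^ 2 - y - z) (y * z / stripMuY₂ 1 y z ^ 2)) / 2 < ‖s'‖ ∧
      ∀ σ : ℂ, σ ^ 2 + (s' - (y : ℂ) * cexp ((t : ℂ) * I) - (z : ℂ)) * σ + (y : ℂ) * cexp ((t : ℂ) * I) * (z : ℂ) / s' = 0 →
        ‖σ‖ ≤ quadRootBound (stripMuY₂ 1 y z ^ 2 - y - z) (y * z / stripMuY₂ 1 y z ^ 2)
          + (stripMuY₂ 1 y z ^ 2 - quadRootBound (stripMuY₂ 1 y z ^ 2 - y - z) (y * z / stripMuY₂ 1 y z ^ 2)) / 2 := by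
  set s := stripMuY₂ 1 y z ^ 2 with hs
  set R₀ := quadRootBound (s - y - z) (y * z / s) with hR₀
  obtain ⟨hR0, hRs⟩ := quadRootBound_cofactor_lt hy hz
  rw [← hs] at hR0 hRs
  change 0 < R₀ at hR0
  change R₀ < s at hRs
  set g := s - R₀ with hg
  have hg0 : 0 < g := by rw [hg]; linarith
  obtain ⟨hsy, hsz⟩ := lt_stripMuY₂_one_sq₂ hy hz
  have hs0 : 0 < s := lt_trans hy hsy
  obtain ⟨hder, hD⟩ := deriv_twoWallCubic_zero hy hz
  rw [← hs] at hder hD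
  set D := (s - y) * (s - z) + s * (s - z) + s * (s - y) with hDdef
  set K₁ := R₀ + g / 2 + 2 * y * z / s ^ 2 with hK₁
  set K₂ := y * (R₀ + g / 2) + 2 * y * z / s with hK₂
  have hK₁0 : 0 < K₁ := by rw [hK₁]; positivity
  have hK₂0 : 0 < K₂ := by rw [hK₂]; positivity
  set d₀ := min (s / 2) (min (g ^ 2 / (8 * K₁ + 8)) (g / 4)) with hd₀
  have hd₀0 : 0 < d₀ := lt_min (by positivity) (lt_min (by positivity) (by positivity))
  obtain ⟨ρ', ⟨hρ'0, hρ'⟩, δ, hδ, H⟩ := exists_complexPerronRoot hy hz one_pos le_rfl hd₀0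
  refine ⟨min δ (g ^ 2 / (8 * K₂ + 8)), lt_min hδ (by positivity), fun t ht => ?_⟩
  obtain ⟨htδ, htK⟩ := lt_min_iff.mp ht
  obtain ⟨s', hs'ball, hF, hloc⟩ := H t htδ
  have hd : ‖s' - (s : ℂ)‖ ≤ d₀ := by
    have h := mem_closedBall.1 hs'ball
    rw [dist_eq_norm] at h
    exact le_trans h hρ'
  have hds : d₀ ≤ s / 2 := min_le_left _ _
  have hd1 : d₀ ≤ g ^ 2 / (8 * K₁ + 8) := le_trans (min_le_right _ _) (min_le_left _ _)
  have hdg : d₀ < g / 2 := lt_of_le_of_lt (le_trans (min_le_right _ _) (min_le_right _ _)) (by linarith)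
  have hnorm : R₀ + g / 2 < ‖s'‖ := rootBound_lt_norm_of_near hy hz hd hdg
  have hs'0 : s' ≠ 0 := by
    intro h
    rw [h, norm_zero] at hnorm
    linarith [hR0, hg0]
  refine ⟨s', hF, hs'0, ?_, hnorm, fun σ hσ => cofactor_roots_le_of_near hy hz hd hds hd1 htK.le hσ⟩
  -- displacement: Newton location (θ = 1) + the size of the perturbation
  have h1 : ‖s' - (s : ℂ)‖ ≤ 2 * ‖twoWallCubic y z (s : ℂ) t‖ / ‖deriv (fun ω => twoWallCubic y z ω 0) (s : ℂ)‖ :=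
    norm_sub_le_of_newton_location le_rfl hloc
  have hnD : ‖deriv (fun ω => twoWallCubic y z ω 0) (s : ℂ)‖ = D := by
    rw [hder, Complex.norm_real, Real.norm_of_nonneg hD.le]
  rw [hnD] at h1
  have h2 := norm_twoWallCubic_real_root_le hy hz t
  rw [← hs] at h2
  calc ‖s' - (s : ℂ)‖ ≤ 2 * ‖twoWallCubic y z (s : ℂ) t‖ / D := h1
    _ ≤ 2 * (y * (s * (s - z) + z) * |t|) / D := by gcongr
    _ = 2 * (y * (s * (s - z) + z)) / D * |t| := by ring

/-- ★★ **Two-term asymptotics along parity classes at complex fugacity.**  With `t₀`, `s'`, `R′` as in `exists_complexPerronData`: for every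
real `|t| < t₀`, every complex sequence `e` with `e(N+6) = (ye^{it} + z)e(N+4) − ye^{it}z·e(N+2) + ye^{it}z·e(N)` (the order-6 two-wall
recurrence — `…WidthOneComplexDecomposition.stripZ₂C_uPart_rec`) satisfies, for each parity offset `c`,
`e(2M+c) = L·s'^M + O((M+1)R′^M)` with the EXPLICIT constant of `exists_tendsto_parity_of_rec_six`, and `R′ < ‖s'‖`.
[cite: Stanley2012EC1, §4.1 Theorem 4.1.1 (iii) (lane statement); BeatonBousquetMelouDeGierDuminilCopinGuttmann2014, §3.2 Proposition 6] -/
theorem exists_tendsto_parity_complexFugacity (hy : 0 < y) (hz : 0 < z) :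
    ∃ t₀ > 0, ∀ t : ℝ, |t| < t₀ → ∃ s' : ℂ,
      twoWallCubic y z s' t = 0 ∧ s' ≠ 0 ∧
      ‖s' - ((stripMuY₂ 1 y z ^ 2 : ℝ) : ℂ)‖
        ≤ 2 * (y * (stripMuY₂ 1 y z ^ 2 * (stripMuY₂ 1 y z ^ 2 - z) + z))
          / ((stripMuY₂ 1 y z ^ 2 - y) * (stripMuY₂ 1 y z ^ 2 - z) + stripMuY₂ 1 y z ^ 2 * (stripMuY₂ 1 y z ^ 2 - z)
              + stripMuY₂ 1 y z ^ 2 * (stripMuY₂ 1 y z ^ 2 - y)) * |t| ∧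
      quadRootBound (stripMuY₂ 1 y z ^ 2 - y - z) (y * z / stripMuY₂ 1 y z ^ 2)
          + (stripMuY₂ 1 y z ^ 2 - quadRootBound (stripMuY₂ 1 y z ^ 2 - y - z) (y * z / stripMuY₂ 1 y z ^ 2)) / 2 < ‖s'‖ ∧
      ∀ e : ℕ → ℂ,
        (∀ N, e (N + 6) = ((y : ℂ) * cexp ((t : ℂ) * I) + (z : ℂ)) * e (N + 4)
            - (y : ℂ) * cexp ((t : ℂ) * I) * (z : ℂ) * e (N + 2) + (y : ℂ) * cexp ((t : ℂ) * I) * (z : ℂ) * e N) →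
        ∀ c : ℕ, ∃ L : ℂ, Tendsto (fun M => e (2 * M + c) / s' ^ M) atTop (𝓝 L) ∧
          ∀ M : ℕ, ‖e (2 * M + c) - L * s' ^ M‖ ≤
            (‖e (2 * 1 + c) - s' * e (2 * 0 + c)‖ + ‖e (2 * 2 + c) - s' * e (2 * 1 + c)‖
                / (quadRootBound (stripMuY₂ 1 y z ^ 2 - y - z) (y * z / stripMuY₂ 1 y z ^ 2)
                    + (stripMuY₂ 1 y z ^ 2 - quadRootBound (stripMuY₂ 1 y z ^ 2 - y - z) (y * z / stripMuY₂ 1 y z ^ 2)) / 2))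
              * ((M : ℝ) + 1)
              * (quadRootBound (stripMuY₂ 1 y z ^ 2 - y - z) (y * z / stripMuY₂ 1 y z ^ 2)
                  + (stripMuY₂ 1 y z ^ 2 - quadRootBound (stripMuY₂ 1 y z ^ 2 - y - z) (y * z / stripMuY₂ 1 y z ^ 2)) / 2) ^ M
              * (‖s'‖ / (‖s'‖ - (quadRootBound (stripMuY₂ 1 y z ^ 2 - y - z) (y * z / stripMuY₂ 1 y z ^ 2)
                  + (stripMuY₂ 1 y z ^ 2 - quadRootBound (stripMuY₂ 1 y z ^ 2 - y - z) (y * z / stripMuY₂ 1 y z ^ 2)) / 2)) ^ 2) := by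
  obtain ⟨t₀, ht₀, H⟩ := exists_complexPerronData hy hz
  obtain ⟨hR0, hRs⟩ := quadRootBound_cofactor_lt hy hz
  refine ⟨t₀, ht₀, fun t ht => ?_⟩
  obtain ⟨s', hF, hs'0, hdisp, hnorm, hroots⟩ := H t ht
  refine ⟨s', hF, hs'0, hdisp, hnorm, fun e he c => ?_⟩
  have hcubic : s' * (s' - (y : ℂ) * cexp ((t : ℂ) * I)) * (s' - (z : ℂ)) = (y : ℂ) * cexp ((t : ℂ) * I) * (z : ℂ) :=
    (twoWallCubic_eq_zero_iff y z s' t).1 hF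
  have hR'0 : 0 < quadRootBound (stripMuY₂ 1 y z ^ 2 - y - z) (y * z / stripMuY₂ 1 y z ^ 2)
      + (stripMuY₂ 1 y z ^ 2 - quadRootBound (stripMuY₂ 1 y z ^ 2 - y - z) (y * z / stripMuY₂ 1 y z ^ 2)) / 2 := by
    have : 0 < stripMuY₂ 1 y z ^ 2 - quadRootBound (stripMuY₂ 1 y z ^ 2 - y - z) (y * z / stripMuY₂ 1 y z ^ 2) := sub_pos.2 hRs
    positivity
  exact exists_tendsto_parity_of_rec_six he hs'0 hcubic hR'0 hnorm hroots c

end WidthOneYZ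

end Literature.Probability.RandomPlanarGeometry.SAW.HexBW

end
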